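import Summits.AtomisticToContinuum.Crystallization.Theorems.ChartedZeroExcessLayeredLatticeLiouvilleTB

/-!
# Zero-excess layered lattice Liouville — part TC (lens-2 g32, node «HarmonicContraction», architecture (II) of the critic's row 536): the node
(HC) `HarmonicContractionPGLms` (= the tree leaves (HD^ms) ∘ (C) without the intermediate `s′`-chart) with its two seams PROVED
(`harmonicContractionPGLms_of_decayms_cacc`: nothing lost; `halvingBasinPGLms_of_reg_contr`: the column), the currencies of the (II)-cut
(`truncLinForce`, `LinResidualSmall`, `HasGradProfile`, `IsAffineLayered`) and the four new typed pieces (E) `LipDualLinearisationP`,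
(A⁰) `L2HarmonicApproxP`, (D⁰) `PositionDecayPL`, (C♭) `PositionCaccioppoliPG`.  The other five pieces of the cut — (T) (part R), (U♮) `UniformTameStability` (part S), (A0), (FF) and the
named residual ★(R_W) `WildFractionPG` (part TB) — are imported; the glue and the columns are part TD.  Split for the gate's 400-line rule.

WHY ARCHITECTURE (II).  The H¹ energy identity of part TB's (A2) tests the Taylor remainder against `u − h` itself, so O(1)-distorted («wild») bonds
enter with an O(1) coefficient and their MASS must be small at EVERY threshold `ϑ` — that is (A1) `∀ϑ`.  Testing instead against LIPSCHITZ fields (E)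
COUNTS wild bonds by Chebyshev (`#wild·ϑ₀² ≤ Σ|δu|² ≤ Cg·η·nK`) with no sparsity at all, and the A-harmonic approximation lemma (A⁰) turns the dual
smallness into POSITION-level closeness to a truncated-harmonic field; decay (D⁰) is linear; the one place where e⋆-GSC minimality and wild-bond sparsity
are consumed is the position-to-gradient Caccioppoli step (C♭) at the contracted radius — and there only at the FIXED tame radius `ϑ₀ = 1/20` of the
potential, i.e. (R_W), the first rung of (A1).  THIN windows (`η·nK(win R) < ϑ₀²/(2Cg)`) have no `ϑ₀`-wild bond at all (PROVED in part TB), so (R_W) is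
needed on FAT windows only.  The stability leaf of the cut is (U♮) `UniformTameStability` (part S, critic row 536 (1)): its TAME witnesses make index balls
physical balls, which (A⁰), (D⁰), (C♭) use on physical/model regions; `uniformEquilStability_of_tame` (part S, proved) recovers (U) where needed.
-/

noncomputable section

open scoped BigOperators InnerProductSpace RealInnerProductSpace
open MeasureTheory Set Metric Filter Topology
open Summit.AtomisticToContinuum.Crystallization.Theorems.ChartedPlanarOrderRigidityDoor
  (E3 IsClean IsNash IsCharted IsEStarGSC VisibleGap PertRegime atomsIn siteEnergy eStar BindingSurface)
open Summit.AtomisticToContinuum.Crystallization.Theorems.ChartedPlanarOrderDensityDichotomy (μS IsSep nK nK_nonneg excess)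
open Summit.AtomisticToContinuum.Crystallization.Theorems.ChartedPlanarOrderMesoCut (IsDoorSet NearHom LayeredHom EnvClose)
open Summit.AtomisticToContinuum.Crystallization.Theorems.OverbindingBudgetLiouvilleDictionary (NearHomBD)
open Summit.AtomisticToContinuum.Crystallization.Theorems.ChartedPlanarOrderDoorLayered
  (TwoPeriodic DoorPeriodic PeriodicBulkGapDoor gap_and_pert_1_50_of_periodic NearHomL2BD nearHomL2BD_mono nearHomBD_of_nearHomL2BD
   sq_le_finsum_mem not_nearHomL2BD_singleton envClose_mono Layered layeredHom_eq_layered atomsIn_subset)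
open Summit.AtomisticToContinuum.Crystallization.Theorems.ChartedPlanarOrderDoorLayeredOsc (IsTwoShellAffineGood DoorPeriodicOsc)
open Summit.AtomisticToContinuum.Crystallization.Theorems.ChartedPlanarOrderCleanScaleP
  (IsCleanP IsDoorSetP DoorPeriodicP isDoorSetP_mono doorPeriodic_of_doorPeriodicP isDoorSetP_one_iff doorPeriodicP_one_iff)
open Summit.AtomisticToContinuum.Crystallization.Theorems.ChartedPlanarOrderProfileSlavingLJ (pairForce)
open Literature.MathematicalPhysics.StatisticalMechanics (haggLabel barlowOffset layerNormal IsHaggSeq triangularVec₁ triangularVec₂)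

namespace Summit.AtomisticToContinuum.Crystallization.Theorems.ChartedZeroExcessLayeredLatticeLiouville

/-! ## §VI.1  Architecture (II) (critic row 536): the node (HC) «harmonic contraction» and its two seams (PROVED) -/

/-- ★ **(HC) «HarmonicContractionPGLms aHi Λ θ s»** — THE NODE OF ARCHITECTURE (II): the composite of the tree leaves (HD^ms)(s,s′) «harmonic decay,
multi-scale» (part T) and (C)(s′) «Caccioppoli» (part Q), typed WITHOUT the intermediate `s′`-chart: «registered-flat at level `η` under an equilibrium
`s`-chart at EVERY scale `D ≥ R` (the multi-scale hypothesis the basin iteration has in hand, part T) ⇒ misfit-flat `NearHomL2BD Λ (c·η)` at the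
contracted radius `t·R`, for every contraction target `c > 0`, with `t = t(δ,a,c) ∈ (0,1]`».  This is EXACTLY what the rigid-chart John leaf consumes:
H♭^ℓ,ms ⟸ (P) ∧ (HC) (PROVED, `halvingBasinPGLms_of_reg_contr`); and nothing is lost: (HC) ⟸ (HD^ms)(s,s′) ∧ (C)(s′) (PROVED,
`harmonicContractionPGLms_of_decayms_cacc`), so every earlier column factors through (HC).  Beneath it part TD cuts (HC) into NINE typed pieces with
the glue PROVED (`harmonicContractionPGLms_of_nine_pieces`): (T) ∧ (U♮) ∧ (A0) global chart registration ∧ (FF) tail-force slaving ∧ (E) Lipschitz-dual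
linearisation ∧ (A⁰) L²-harmonic approximation ∧ (D⁰) position-level decay ∧ (C♭) position-level Caccioppoli ∧ ★(R_W) the wild fraction at the tame
radius — the ONE named residual.  The old leaf (C) «CaccioppoliPGL» is NOT used by the new column: it is replaced by (C♭), which consumes (R_W)
explicitly instead of silently.  DECAY-type; TRUE-type (implied by the tree leaves HD, C). [this file, g32] -/
def HarmonicContractionPGLms (aHi Λ θ s : ℝ) : Prop :=
  LatticeLiouvilleCert → LayeredLiouvilleCert → ∀ δ : ℝ, 0 < δ → ∀ a : ℝ, 0 < a → ∀ c : ℝ, 0 < c →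
    ∃ t : ℝ, 0 < t ∧ t ≤ 1 ∧ ∃ η₁ : ℝ, 0 < η₁ ∧ ∃ R₁ : ℝ, 0 < R₁ ∧
      ∀ S : Set E3, IsDoorSetPG aHi δ S → (∀ q ∈ S, IsTwoShellAffineGood θ S q) →
        ∀ η : ℝ, 0 < η → η ≤ η₁ → ∀ R : ℝ, R₁ ≤ R →
          (∀ D : ℝ, R ≤ D → NearHomH1BDE a s Λ η 4 D S (atomsIn (μS S) 0 D)) →
            NearHomL2BD Λ (c * η) 4 S (atomsIn (μS S) 0 (t * R))

/-- seam (nothing lost): (HC) ⟸ (HD^ms)(s,s′) ∧ (C)(s′) — compose the multi-scale decay leaf with the tree's Caccioppoli leaf at the `s′`-chart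
(PROVED; `t := t_HD/M_C`, levels `c/C_C`). [this file, g32] -/
theorem harmonicContractionPGLms_of_decayms_cacc {aHi Λ θ s s' : ℝ} (hH : HarmonicDecayPGLms aHi Λ θ s s')
    (hC : CaccioppoliPGL aHi Λ θ s') : HarmonicContractionPGLms aHi Λ θ s := by
  intro hL hL' δ hδ a ha c hc
  obtain ⟨Cc, hCc, Mc, hMc, ηc, hηc, Rc, hRc, hC'⟩ := hC δ hδ a ha
  have hCc0 : 0 < Cc := zero_lt_one.trans_le hCc
  have hMc0 : 0 < Mc := zero_lt_one.trans_le hMc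
  obtain ⟨t, ht, ht1, η₁, hη₁, R₁, hR₁, hH'⟩ := hH hL hL' δ hδ a ha (c / Cc) (div_pos hc hCc0)
  refine ⟨t / Mc, div_pos ht hMc0, (div_le_self ht.le hMc).trans ht1, min η₁ (Cc * ηc / c), lt_min hη₁ (by positivity),
    max R₁ (Mc * Rc / t), lt_max_of_lt_left hR₁, fun S hSd hg η hη hηle R hR hms => ?_⟩
  have hR1_R : R₁ ≤ R := (le_max_left _ _).trans hR
  have hR2 : Mc * Rc / t ≤ R := (le_max_right _ _).trans hR
  -- (HD^ms): registered-flat at every scale `≥ R` ⇒ registered-flat under an `s′`-chart at `t·R`, level `(c/C_C)·η`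
  have h1 := hH' S hSd hg η hη (hηle.trans (min_le_left _ _)) R hR1_R hms
  -- (C) at radius `t·R/M_C`
  have hlev : c / Cc * η ≤ ηc := by
    have h := (le_div_iff₀ hc).1 (hηle.trans (min_le_right _ _))
    rw [div_mul_eq_mul_div, div_le_iff₀ hCc0]
    linarith [mul_comm η c, mul_comm ηc Cc]
  have hrad : Rc ≤ t * R / Mc := by
    rw [div_le_iff₀ ht] at hR2
    rw [le_div_iff₀ hMc0]
    linarith [mul_comm Rc Mc, mul_comm R t]
  have hrad2 : Mc * (t * R / Mc) = t * R := by field_simp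
  have h2 := hC' S hSd hg (c / Cc * η) (by positivity) hlev (t * R / Mc) hrad (by rw [hrad2]; exact h1)
  have hfin : Cc * (c / Cc * η) = c * η := by field_simp
  have hrad3 : t / Mc * R = t * R / Mc := by ring
  rw [hfin] at h2
  rw [hrad3]
  exact h2

/-- ★ seam (the column): H♭^ℓ,ms ⟸ (P) ∧ (HC) — the rigid-chart John leaf from registration and harmonic contraction (PROVED; `M := M_P/t`,
contraction target `c := 1/(2·C_P)`). [this file, g32] -/
theorem halvingBasinPGLms_of_reg_contr {aHi Λ θ s : ℝ} (hP : RegistrationP aHi Λ θ s) (hH : HarmonicContractionPGLms aHi Λ θ s) :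
    HalvingBasinPGLms aHi Λ θ s := by
  intro hL hL' δ hδ a ha
  obtain ⟨CP, hCP, MP, hMP, ηP, hηP, RP, hRP, hP'⟩ := hP δ hδ a ha
  have hCP0 : 0 < CP := zero_lt_one.trans_le hCP
  have hMP0 : 0 < MP := zero_lt_one.trans_le hMP
  obtain ⟨t, ht, ht1, η₁, hη₁, R₁, hR₁, hH'⟩ := hH hL hL' δ hδ a ha (1 / (2 * CP)) (by positivity)
  have hM1 : 1 ≤ MP / t := hMP.trans (le_div_self hMP0.le ht ht1)
  refine ⟨min ηP (η₁ / CP), lt_min hηP (div_pos hη₁ hCP0), MP / t, hM1, max RP R₁, lt_max_of_lt_left hRP,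
    fun S hSd hg η hη hηle R hR hflat => ?_⟩
  have hRP_R : RP ≤ R := (le_max_left _ _).trans hR
  have hR1_R : R₁ ≤ R := (le_max_right _ _).trans hR
  have hR0 : 0 ≤ R := hRP.le.trans hRP_R
  have hRt : R ≤ R / t := le_div_self hR0 ht ht1
  -- (P) at every scale `D ≥ R/t`: misfit-flat at `M_P·D` ⇒ registered-flat at `D`
  have hregms : ∀ D : ℝ, R / t ≤ D → NearHomH1BDE a s Λ (CP * η) 4 D S (atomsIn (μS S) 0 D) := by
    intro D hD
    refine hP' S hSd.1 hg η hη (hηle.trans (min_le_left _ _)) D (hRP_R.trans (hRt.trans hD)) (hflat (MP * D) ?_)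
    calc MP / t * R = MP * (R / t) := by ring
      _ ≤ MP * D := mul_le_mul_of_nonneg_left hD hMP0.le
  -- (HC): registered-flat at every scale `≥ R/t` ⇒ misfit-flat at `t·(R/t) = R`, level `η/2`
  have hlev1 : CP * η ≤ η₁ := by
    have h := hηle.trans (min_le_right _ _)
    rw [le_div_iff₀ hCP0] at h
    linarith [mul_comm η CP]
  have h2 := hH' S hSd hg (CP * η) (by positivity) hlev1 (R / t) (hR1_R.trans hRt) hregms
  have hrad : t * (R / t) = R := by field_simp
  have hfin : 1 / (2 * CP) * (CP * η) = η / 2 := by field_simp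
  rw [hrad, hfin] at h2
  exact h2

/-! ## §VI.2  Currencies of the (II)-cut: truncated linearised force, Lipschitz-dual residual, gradient profile, affine-layered Taylor class -/

/-- ★ **the `ϱ`-truncated linearised force** of the displacement `u := id − Ψ` at the atom `x` (registration `Ψ : S → H`): `Σ_{p ∈ S, dist(Ψ p, Ψ x) ≤ ϱ}
forceConst (Ψ p − Ψ x) (u p − u x)` — the operator whose kernel is `IsTruncHarmonic ϱ H` (part R), evaluated on `u ∘ Ψ⁻¹` (the sum is finite for a
global registration of a separated `S`; junk `0` otherwise).  By the single-site force balance of `S` AND of the chart `H` (tree theorem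
`hasSum_pairForce_of_isNash`) it equals MINUS the Taylor remainder of the near bonds MINUS `tailForce ϱ` — the identity (E) linearises. [this file, g32] -/
def truncLinForce (ϱ : ℝ) (S : Set E3) (Ψ : E3 → E3) (x : E3) : E3 :=
  ∑ᶠ p ∈ {p : E3 | p ∈ S ∧ dist (Ψ p) (Ψ x) ≤ ϱ}, forceConst (Ψ p - Ψ x) ((p - Ψ p) - (x - Ψ x))

/-- ★ **Lipschitz-dual smallness of the linearisation residual** at `(εr, ϱ, η, R)`: against every test field `φ` on the MODEL, supported in
`H ∩ closedBall (Ψ 0) (R/8)` and `ℓ`-Lipschitz on `H`, the work of the truncated linearised force over the window is `≤ εr·√η·ℓ·nK(win R)` — the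
`(W^{1,∞})*`-norm of the A-harmonic approximation lemma (Duzaar–Grotowski–Steffen; Beck 2016 Lemma 4.27), in which wild bonds are COUNTED
(Chebyshev), not weighed. [this file, g32] -/
def LinResidualSmall (εr ϱ η R : ℝ) (S H : Set E3) (Ψ : E3 → E3) : Prop :=
  ∀ φ : E3 → E3, (∀ q : E3, q ∉ H ∩ closedBall (Ψ 0) (R / 8) → φ q = 0) →
    ∀ ℓ : ℝ, 0 ≤ ℓ → (∀ q ∈ H, ∀ q' ∈ H, ‖φ q' - φ q‖ ≤ ℓ * dist q' q) →
      |∑ᶠ x ∈ atomsIn (μS S) 0 R, ⟪truncLinForce ϱ S Ψ x, φ (Ψ x)⟫_ℝ| ≤ εr * Real.sqrt η * ℓ * nK (atomsIn (μS S) 0 R)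

/-- the dual residual bound is monotone in the tolerance (PROVED; used by the glue to pass from `C_E·√η + C_ℓ·εf` to `εr`). [this file, g32] -/
theorem linResidualSmall_mono {εr εr' ϱ η R : ℝ} (hεr : εr ≤ εr') {S H : Set E3} {Ψ : E3 → E3} (h : LinResidualSmall εr ϱ η R S H Ψ) :
    LinResidualSmall εr' ϱ η R S H Ψ := fun φ hφ ℓ hℓ hlip =>
  (h φ hφ ℓ hℓ hlip).trans (mul_le_mul_of_nonneg_right (mul_le_mul_of_nonneg_right
    (mul_le_mul_of_nonneg_right hεr (Real.sqrt_nonneg η)) hℓ) (nK_nonneg _))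

/-- **gradient profile at level `κ`** of a model field `h` on the model region `P ⊆ H`, normalised by the configuration window `Q`: a `4`-increment
profile `σ ≥ 0` on `P` with `Σ_P σ² ≤ κ·nK Q` (the `σ`-clauses of part R's `IsHarmSplit`, isolated). [this file, g32] -/
def HasGradProfile (κ : ℝ) (H P Q : Set E3) (h : E3 → E3) : Prop :=
  ∃ σ : E3 → ℝ, (∀ q ∈ P, 0 ≤ σ q ∧ ∀ q' ∈ H, dist q' q ≤ 4 → ‖h q' - h q‖ ≤ σ q) ∧ ∑ᶠ q ∈ P, σ q ^ 2 ≤ κ * nK Q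

/-- ★ **the affine-layered Taylor class** of the chart `(L, w)` (the `LayeredLiouvilleCert` class at model level): `T` is, on the model set
`LayeredHom L w = {L(i·t₁ + j·t₂) + w m}`, a COMMON linear map `A` of the in-layer lattice position plus a FREE constant `b m` per layer — the degree-one
Taylor polynomials of truncated-harmonic laminate fields (tangentially affine, normal behaviour absorbed layer by layer). [this file, g32] -/
def IsAffineLayered (L : E3 →L[ℝ] E3) (w : ℤ → E3) (T : E3 → E3) : Prop :=
  ∃ (A : E3 →L[ℝ] E3) (b : ℤ → E3), ∀ m i j : ℤ,
    T (L (((i : ℝ) • triangularVec₁ 1) + ((j : ℝ) • triangularVec₂ 1)) + w m) =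
      A (L (((i : ℝ) • triangularVec₁ 1) + ((j : ℝ) • triangularVec₂ 1))) + b m

/-- a global registration at constant `Cg` is one at every larger constant (PROVED; the thin branch of the glue upgrades `Cg ↦ Cg'`). [this file, g32] -/
theorem isGlobalReg_mono {Cg Cg' η R : ℝ} (hC : Cg ≤ Cg') (hη : 0 ≤ η) (hR : 0 < R) {S H : Set E3} {Ψ : E3 → E3}
    (h : IsGlobalReg Cg η R S H Ψ) : IsGlobalReg Cg' η R S H Ψ := by
  obtain ⟨h1, h2, h3, h4⟩ := h
  refine ⟨h1, h2, h3, fun D hD => ?_⟩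
  obtain ⟨τ, hτ⟩ := h4 D hD
  exact ⟨τ, hτ.mono (mul_le_mul_of_nonneg_right (mul_le_mul_of_nonneg_right hC (div_nonneg (hR.le.trans hD) hR.le)) hη)⟩

/-! ## §VI.3  The four new pieces beneath (HC): (E), (A⁰), (D⁰), (C♭) — (T) (part R), (U♮) `UniformTameStability` (part S; the single stability leaf, critic row 536 (1)), (A0), (FF), (R_W) (part TB) -/

/-- ★ **(E) «LipDualLinearisationP aHi Λ θ s»** — `H⁻¹`/LIPSCHITZ-DUAL LINEARISATION, GSC-FREE BY TYPE (door `IsDoorSetP`): for every `δ, a, Cg` there is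
a GEOMETRIC constant `C_ℓ ≥ 1` (chosen BEFORE the range, so that the glue can fix the tail tolerance `εf := εr/(2C_ℓ)` before (FF) fixes `ϱ`), and for
every range `ϱ ≥ 1` a Taylor constant `C_E(ϱ) ≥ 1` with: «globally registered at `(Cg, η, R)` to an equilibrium `s`-chart and tail force `εf`-dual-small
⇒ the truncated linearisation residual is Lipschitz-dual small with tolerance `C_E·√η + C_ℓ·εf`».  Mechanism: exact force balance of `S` and of the
chart (`hasSum_pairForce_of_isNash`, tree) gives `truncLinForce = −G_tay − tailForce`; TAME bonds (`|δu_e| < ϑ₀ := tameRadius`): `|g_e| ≤ C|δu_e|²`, summed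
against `|δφ| ≤ 8ℓ`: `≤ C·ℓ·Σ|δu|² ≤ C·Cg·η·ℓ·nK`; WILD bonds: `|g_e| ≤ C(1 + |δu_e|)` and they are COUNTED by Chebyshev, `#wild·ϑ₀² + Σ_wild|δu|·ϑ₀ ≤
2·C·Cg·η·nK` — NO sparsity hypothesis is needed in this norm (the point of architecture (II)); the tail term is (FF)'s bound transported to the model
by the bijection `Ψ` (bond energy of `φ∘Ψ` `≤ C·ℓ²·nK`), whence `C_ℓ·εf`.  LINEARISATION-type; WEAKER THAN (HC) · TRUE-type · ATTACKABLE·M.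
Why it might fail: the support/test-class transport `φ ↦ φ∘Ψ` from the model ball `closedBall (Ψ 0) (R/8)` (+ a `ϱ`-collar for the action–reaction
symmetrisation) into `FarDualSmall`'s configuration support `win (R/2)` (resp. into the summation window `win R`) is done with the COARSE chain constant of
the two-sided tear-free clauses of `IsGlobalReg` (model `4`-chains advance `≥ 4 − 2·r_cov(H)` per step, configuration steps `≤ 8`: factor `≈ 3.6 < 4`,
so `Ψ⁻¹(B(Ψ0, R/8 + ϱ)) ⊂ win (0.46·R + 3.7·ϱ + 8) ⊂ win (R/2)` for `R ≥ R₁(ϱ)`) — if an equilibrium chart had covering radius `≥ 1` the factor reaches `4`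
and the finer `η^{1/3}·R` drift lemma (disjoint chains + Chebyshev on `Σ τ² ≤ Cg·η·nK`, tear-free caps `τ ≤ 12`) is needed instead; the `√η` (not `η`)
rate is what Chebyshev counting affords and is all (A⁰) needs.
Sources: [Beck2016 §4.3.2, Lemma 4.27 p.118 (galaxy:pdf:8146166563808928060)], [giaquinta1984 Ch. IV], [OrtnerTheil2013 (atomistic linearisation
consistency)], [this tree: `hasSum_pairForce_of_isNash`, `forceConst`]. [this file, g32] -/
def LipDualLinearisationP (aHi Λ θ s : ℝ) : Prop :=
  ∀ δ : ℝ, 0 < δ → ∀ a : ℝ, 0 < a → ∀ Cg : ℝ, 1 ≤ Cg → ∃ Cl : ℝ, 1 ≤ Cl ∧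
    ∀ ϱ : ℝ, 1 ≤ ϱ → ∃ CE : ℝ, 1 ≤ CE ∧ ∃ η₁ : ℝ, 0 < η₁ ∧ ∃ R₁ : ℝ, 0 < R₁ ∧
      ∀ S : Set E3, IsDoorSetP aHi δ S → (∀ q ∈ S, IsTwoShellAffineGood θ S q) →
        ∀ η : ℝ, 0 < η → η ≤ η₁ → ∀ R : ℝ, R₁ ≤ R →
          ∀ (L : E3 ≃L[ℝ] E3) (w : ℤ → E3), IsEquilChart a s Λ L w →
            ∀ Ψ : E3 → E3, IsGlobalReg Cg η R S (LayeredHom (L : E3 →L[ℝ] E3) w) Ψ →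
              ∀ εf : ℝ, 0 < εf → FarDualSmall εf ϱ η R S (LayeredHom (L : E3 →L[ℝ] E3) w) Ψ →
                LinResidualSmall (CE * Real.sqrt η + Cl * εf) ϱ η R S (LayeredHom (L : E3 →L[ℝ] E3) w) Ψ

/-- ★ **(A⁰) «L2HarmonicApproxP aHi Λ θ s»** — THE L²-HARMONIC APPROXIMATION LEMMA IN QUANTITATIVE/DUALITY FORM, GSC-FREE BY TYPE (door
`IsDoorSetP`): given (T) and (U♮), for every `δ, a, Cg` there is `C_A ≥ 1`, and for every closeness `ε > 0` an EXPLICIT residual tolerance `εr(ε) > 0` and a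
range floor, such that «globally registered at `(Cg, η, R)` to an equilibrium `s`-chart `H` with linearisation residual `εr`-Lipschitz-dual-small ⇒
there is a `ϱ`-truncated-HARMONIC model field `h` on `H ∩ B(Ψ0, R/8)` with gradient profile `≤ C_A·η` on `H ∩ B(Ψ0, R/2)` which is POSITION-close to
the displacement: `Σ_{win r} ‖u − h∘Ψ‖² ≤ ε·η·R²·nK(win R)` for every `r ≤ R/64`».  Mechanism: normalise `v := u∘Ψ⁻¹/√(Cg·η)` (bond energy `≤ C·nK`,
residual `≤ (εr/√Cg)·ℓ·nK`); compactness–contradiction over the COMPACT family of equilibrium layered charts `(L, w)` (conformal slice, `IsHaggSeq`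
words) and registered geometries, with the coercivity (U♮) − (T) of the limit operators (tame witnesses: index balls ARE physical balls) at range `ϱ ≥ ϱ₁(κ₀)` supplying uniqueness/regularity of the
truncated-harmonic limit; or directly by duality (Diening–Stroffolini–Verde-type explicit modulus `εr = ε^C`).  LINEAR; WEAKER THAN (HC) (no minimality,
no position-to-gradient conversion) · TRUE-type · ATTACKABLE·M–L.
Why it might fail: uniformity of `εr(ε)` over the non-compact part of the geometry (the registered sets `Ψ(win r)` sandwiched between model balls only
up to the tear-free constants) and over aperiodic Hägg words must come out of the contradiction argument; the discrete Rellich step needs the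
bond-energy bound on a ball STRICTLY larger than `B(Ψ0, R/8)` (available: `IsGlobalReg` at scale `R`); the closeness windows `win r`, `r ≤ R/64`, sit
inside HALF the harmonic ball, `Ψ(win (R/64)) ⊂ B(Ψ0, 3.7·R/64 + 8) ⊂ B(Ψ0, R/16)`, only by the coarse chain constant `< 4` of the tear-free clauses (`R ≥ R₁`).
Sources: [Beck2016 Lemma 4.27 p.118, §4.3 (galaxy:pdf:8146166563808928060)], [DuzaarGrotowski2000 (A-harmonic approximation)], [DieningStroffoliniVerde2012
(quantitative harmonic approximation by duality)], [giaquinta1984 p.120 Thm 3.1]. [this file, g32] -/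
def L2HarmonicApproxP (aHi Λ θ s : ℝ) : Prop :=
  TailDominationCert → UniformTameStability s Λ →
    ∀ δ : ℝ, 0 < δ → ∀ a : ℝ, 0 < a → ∀ Cg : ℝ, 1 ≤ Cg → ∃ CA : ℝ, 1 ≤ CA ∧
      ∀ ε : ℝ, 0 < ε → ∃ εr : ℝ, 0 < εr ∧ ∃ ϱ₁ : ℝ, 1 ≤ ϱ₁ ∧ ∀ ϱ : ℝ, ϱ₁ ≤ ϱ → ∃ η₁ : ℝ, 0 < η₁ ∧ ∃ R₁ : ℝ, 0 < R₁ ∧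
        ∀ S : Set E3, IsDoorSetP aHi δ S → (∀ q ∈ S, IsTwoShellAffineGood θ S q) →
          ∀ η : ℝ, 0 < η → η ≤ η₁ → ∀ R : ℝ, R₁ ≤ R →
            ∀ (L : E3 ≃L[ℝ] E3) (w : ℤ → E3), IsEquilChart a s Λ L w →
              ∀ Ψ : E3 → E3, IsGlobalReg Cg η R S (LayeredHom (L : E3 →L[ℝ] E3) w) Ψ →
                LinResidualSmall εr ϱ η R S (LayeredHom (L : E3 →L[ℝ] E3) w) Ψ →
                  ∃ h : E3 → E3,
                    IsTruncHarmonic ϱ (LayeredHom (L : E3 →L[ℝ] E3) w) h (LayeredHom (L : E3 →L[ℝ] E3) w ∩ closedBall (Ψ 0) (R / 8)) ∧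
                    HasGradProfile (CA * η) (LayeredHom (L : E3 →L[ℝ] E3) w) (LayeredHom (L : E3 →L[ℝ] E3) w ∩ closedBall (Ψ 0) (R / 2))
                      (atomsIn (μS S) 0 R) h ∧
                    ∀ r : ℝ, 0 < r → r ≤ R / 64 →
                      ∑ᶠ x ∈ atomsIn (μS S) 0 r, ‖(x - Ψ x) - h (Ψ x)‖ ^ 2 ≤ ε * η * R ^ 2 * nK (atomsIn (μS S) 0 R)

/-- ★ **(D⁰) «PositionDecayPL aHi Λ θ s»** — POSITION-LEVEL DECAY OF TRUNCATED-HARMONIC MODEL FIELDS TOWARD THE AFFINE-LAYERED TAYLOR CLASS, LINEAR,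
GSC-FREE BY TYPE (door `IsDoorSetP`; the re-chart dictionary of g31's (D₂) is built in — the decay is sampled at the registered images `Ψ(win 2tR)`): given
(T), (U♮) and the layered Liouville certificate, for every `δ, a, Cg, C_A` there are `C_D ≥ 1` and a range floor such that for every range `ϱ ≥ ϱ₁` and every
ratio `t ≤ 1/128`: «`h` truncated-harmonic on `H ∩ B(Ψ0, R/8)` with gradient profile `≤ C_A·η` on `H ∩ B(Ψ0, R/2)` ⇒ some affine-layered `T` has
`Σ_{win 2tR} ‖h∘Ψ − T∘Ψ‖² ≤ C_D·t⁷·R²·η·nK(win R)`» (`t⁴` = degree-one Taylor decay at position level, `t³` = the count of the sub-window).  It is g31's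
(D₁) «InteriorDecayCert» (gradient excess decay `t²`) + the discrete Poincaré inequality per layer with free constants + the tame re-indexing of (D₂),
by name.  DECAY-type (linear); WEAKER THAN (HC) · TRUE-type-indicated (census TRUNC-DECAY, TAG 184) · ATTACKABLE·M.
Why it might fail: interior regularity of truncated-harmonic LAMINATE fields with an aperiodic Hägg word gives tangential smoothness but the normal
direction is only as regular as the layer-chain operator allows — the per-layer constants `b m` of `IsAffineLayered` must absorb exactly that; the
sampling set `Ψ(win 2tR)` sits inside HALF the harmonic ball, `B(Ψ0, R/16)`, only by the coarse chain constant `< 4` of the tear-free clauses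
(`3.7·2t·R + 8 ≤ R/16` needs `t ≤ 1/128`, `R ≥ R₁`).
Sources: [giaquinta1984 Ch. III (Campanato decay for systems with constant coefficients)], [Beck2016 §4.3], [this tree/cell: g31 (D₁) InteriorDecayCert,
(D₂), census TRUNC-DECAY TAG 184], [EMing2006 §4]. [this file, g32] -/
def PositionDecayPL (aHi Λ θ s : ℝ) : Prop :=
  TailDominationCert → UniformTameStability s Λ → LayeredLiouvilleCert →
    ∀ δ : ℝ, 0 < δ → ∀ a : ℝ, 0 < a → ∀ Cg : ℝ, 1 ≤ Cg → ∀ CA : ℝ, 1 ≤ CA → ∃ CD : ℝ, 1 ≤ CD ∧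
      ∃ ϱ₁ : ℝ, 1 ≤ ϱ₁ ∧ ∀ ϱ : ℝ, ϱ₁ ≤ ϱ → ∀ t : ℝ, 0 < t → t ≤ 1 / 128 → ∃ η₁ : ℝ, 0 < η₁ ∧ ∃ R₁ : ℝ, 0 < R₁ ∧
        ∀ S : Set E3, IsDoorSetP aHi δ S → (∀ q ∈ S, IsTwoShellAffineGood θ S q) →
          ∀ η : ℝ, 0 < η → η ≤ η₁ → ∀ R : ℝ, R₁ ≤ R →
            ∀ (L : E3 ≃L[ℝ] E3) (w : ℤ → E3), IsEquilChart a s Λ L w →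
              ∀ Ψ : E3 → E3, IsGlobalReg Cg η R S (LayeredHom (L : E3 →L[ℝ] E3) w) Ψ →
                ∀ h : E3 → E3,
                  IsTruncHarmonic ϱ (LayeredHom (L : E3 →L[ℝ] E3) w) h (LayeredHom (L : E3 →L[ℝ] E3) w ∩ closedBall (Ψ 0) (R / 8)) →
                  HasGradProfile (CA * η) (LayeredHom (L : E3 →L[ℝ] E3) w) (LayeredHom (L : E3 →L[ℝ] E3) w ∩ closedBall (Ψ 0) (R / 2))
                    (atomsIn (μS S) 0 R) h →
                    ∃ T : E3 → E3, IsAffineLayered (L : E3 →L[ℝ] E3) w T ∧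
                      ∑ᶠ x ∈ atomsIn (μS S) 0 (2 * t * R), ‖h (Ψ x) - T (Ψ x)‖ ^ 2 ≤
                        CD * t ^ 7 * R ^ 2 * η * nK (atomsIn (μS S) 0 R)

/-- ★★ **(C♭) «PositionCaccioppoliPG aHi Λ θ s»** — POSITION-LEVEL CACCIOPPOLI AT THE CONTRACTED RADIUS, CONSUMING THE WILD FRACTION EXPLICITLY (door
`IsDoorSetPG`: e⋆-GSC energy comparison): given (T) and (U♮), for every `δ, a, Cg` there is `C♭ ≥ 1` such that for every ratio `t ≤ 1/128` (ceiling/floor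
after it): «globally registered at `(Cg, η, R)` to an equilibrium `s`-chart; on `win 2tR` the displacement is position-close to `h∘Ψ` at level `κ₁` and
`h∘Ψ` to an affine-layered `T∘Ψ` at level `κ₂` (levels in units `(tR)²·t³·nK(win R)`); the `ϑ₀`-wild mass of the WHOLE window is `≤ κw·t³·nK(win R)` ⇒
misfit-flat `NearHomL2BD Λ (C♭·(κ₁ + κ₂ + κw))` at radius `t·R`» (under the strained chart `((1 + A)·L, w + b)` of `T`).  Mechanism: Evans–Giaquinta
two-inequality scheme with hole-filling for the e⋆-GSC inequality against the competitor `Ψ⁻¹-imaged affine-layered configuration inside, actual outside,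
cut off on the collar` — collar cost `(tR)⁻²·Σ|u − T∘Ψ|²` (the position term), tame bonds convex (`tameRadius_convex`), wild bonds `≤ C·(mass + count)
≤ C(1 + ϑ₀⁻²)·κw·t³·nK`, Chebyshev-bad collar atoms deleted at price `|e⋆|` each; then FJM rigidity of the near-affine interior.  This is the tree leaf
(C) «CaccioppoliPGL» re-typed at position level with its silent sparsity input made EXPLICIT (`κw`) — (C) is not used by this column.
CACCIOPPOLI-type; WEAKER THAN (HC) · TRUE-type-expected · ATTACKABLE·M–L (needs the X-type core-slice Gårding of (U♮), TAG 174 (a‴)/(a⁗)).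
Why it might fail: the strained chart `(1 + A)·L` must keep `‖·‖, ‖·⁻¹‖ ≤ Λ` (room only because cleanliness pins the scale `a ≈ 1 ≪ Λ = 2` at the column
literals) and be re-equilibrated in its layer heights (the `ℓ^∞` layer-chain implicit function of (D₂)); hole-filling needs the collar gradient term at
relative level `Cg·η·t⁻³`, harmless only after `η ≤ η₁(t)`; the Taylor class `IsAffineLayered` has FREE per-layer offsets `b` (a superset of the
layered Liouville class), so the reference `((1 + A)·L, w + b)` carries a layerwise-constant residual force `f_m` — it is self-consistently
`O(√κ·(tR)⁻¹)` (test the equilibrium equations against layerwise-constant cut-offs), or `b` is first re-fitted to equilibrium offsets; the OUTPUT chart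
may keep free offsets (`NearHomL2BD` has free stacking data `w`), and the e⋆-GSC inequality `IsEStarGSC` is EXACT grand-canonical minimality (no
surface slack), so no `(tR)⁻¹` floor enters.
Sources: [Evans1986], [giaquinta1984 Ch. IV, V (Caccioppoli, hole filling)], [kruzik2019 p.55 Thm 1.1.12 (FJM rigidity)], [Theil2006 §4], [FlatleyTheil2015],
[this tree: part Q (C) CaccioppoliPGL docstring, `IsEStarGSC`]. [this file, g32] -/
def PositionCaccioppoliPG (aHi Λ θ s : ℝ) : Prop :=
  TailDominationCert → UniformTameStability s Λ →
    ∀ δ : ℝ, 0 < δ → ∀ a : ℝ, 0 < a → ∀ Cg : ℝ, 1 ≤ Cg → ∃ Cb : ℝ, 1 ≤ Cb ∧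
      ∀ t : ℝ, 0 < t → t ≤ 1 / 128 → ∃ η₁ : ℝ, 0 < η₁ ∧ ∃ R₁ : ℝ, 0 < R₁ ∧
        ∀ S : Set E3, IsDoorSetPG aHi δ S → (∀ q ∈ S, IsTwoShellAffineGood θ S q) →
          ∀ η : ℝ, 0 < η → η ≤ η₁ → ∀ R : ℝ, R₁ ≤ R →
            ∀ (L : E3 ≃L[ℝ] E3) (w : ℤ → E3), IsEquilChart a s Λ L w →
              ∀ Ψ : E3 → E3, IsGlobalReg Cg η R S (LayeredHom (L : E3 →L[ℝ] E3) w) Ψ →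
                ∀ (h T : E3 → E3), IsAffineLayered (L : E3 →L[ℝ] E3) w T →
                  ∀ κ₁ κ₂ κw : ℝ, 0 ≤ κ₁ → 0 ≤ κ₂ → 0 ≤ κw →
                    ∑ᶠ x ∈ atomsIn (μS S) 0 (2 * t * R), ‖(x - Ψ x) - h (Ψ x)‖ ^ 2 ≤
                        κ₁ * (t * R) ^ 2 * (t ^ 3 * nK (atomsIn (μS S) 0 R)) →
                      ∑ᶠ x ∈ atomsIn (μS S) 0 (2 * t * R), ‖h (Ψ x) - T (Ψ x)‖ ^ 2 ≤
                          κ₂ * (t * R) ^ 2 * (t ^ 3 * nK (atomsIn (μS S) 0 R)) →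
                        wildMass tameRadius (atomsIn (μS S) 0 R) Ψ ≤ κw * (t ^ 3 * nK (atomsIn (μS S) 0 R)) →
                          NearHomL2BD Λ (Cb * (κ₁ + κ₂ + κw)) 4 S (atomsIn (μS S) 0 (t * R))

end Summit.AtomisticToContinuum.Crystallization.Theorems.ChartedZeroExcessLayeredLatticeLiouville

end
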